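import Literature.AlgebraicGeometry.Frobenioids.ArchimedeanProp35iiCounterexample
import Literature.AlgebraicGeometry.Frobenioids.IsoSubanchorNotIsotropic
import Mathlib.CategoryTheory.Limits.Shapes.Equalizers
import Mathlib.CategoryTheory.Category.Preorder
import HarnessLib

/-!
# Frobenioids I, Remark 3.1.1 and Prop. 3.3 (ii) as the schemata `Remark311 S`, `Prop33ii S` over the BARE
# operations interface: the universal closures are false (Remark 3.1.1 already at a genuine PRE-Frobenioid
# whose base is not totally epimorphic; Prop. 3.3 (ii) at junk operations on the walking parallel pair)

Mochizuki, *The geometry of Frobenioids I: the general theory*, Kyushu J. Math. **62** (2008) 293–400,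
§3, Remark 3.1.1, kurims p. 57: "An iso-subanchor of the Frobenioid `C` is never isotropic" (printed proof
via Prop. 1.10 (iv), Def. 1.3 (vii)(b), Prop. 1.9 (v), Def. 1.3 (v)(a) — all for FROBENIOIDS, whose base
category is totally epimorphic by Def. 1.3) [cite: MochizukiFrdI2008, Rem. 3.1.1 p.57].

PROOF-ONLY companion (no definitions, no instances) of `BaseCategoryTheoreticityDefs.lean` (seat
abc-iut-L1-t3); cell abc-iut, block F, seat abc-iut-f-045.  FACT-LIST row **F-0920**
`Remark311 S := ∀ A, IsIsoSubanchor A → ¬ S.IsIsotropic A` is a conclusion predicate in the operations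
`S : PreFrobenioidData C D` of Def. 1.1 (iv), asserted in print for Frobenioids and PROVED there:
`remark311_holds (hF : IsFrobenioid F)` (`IsoSubanchorNotIsotropic.lean`) — cited, not restated.  The R7
kernel TYPE-audit (abc-iut-w5-d199 v2: «[binders 7 vs 5; Prop-hyps: IsFrobenioid]») found no theorem
concluding the closure over ALL `S`, and it is FALSE — not merely at junk operations but at the honest
operations `ofFunctor` of a genuine PRE-Frobenioid: abc-iut's [FrdII] Prop. 3.5 (ii) counterexample
(`ArchimedeanProp35iiCounterexample.lean`), the archimedean category `C = C₀ ×_{D₀} D` of [FrdII] Ex. 3.3 (i)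
over the retract base `D = RB` (a point `pt` and a two-point set `two`, all maps — connected but NOT totally
epimorphic), has the object `U pt` which is simultaneously an ISO-SUBANCHOR (`ArchFrd.isIsoSubanchor_unit`)
and ISOTROPIC (`ArchFrd.isIsotropic_unit`).  So:
* `not_remark311_archRetract` — `Remark311` fails for `ofFunctor _ (ArchFrd.C.toElem ArchFrd.πR)`;
* `not_forall_remark311` — the universal closure of F-0920 (level `0`) is FALSE.
Also FACT-LIST row **F-0916** `Prop33ii S` (Prop. 3.3 (ii) p. 59: "`α₁ ≈^{O^×} α₂` iff `deg_Fr`, `Div`,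
`Base` agree"; closed twin F-0706 `FrdI.Prop33ii_holds` PROVED for every Frobenioid):
* `not_forall_prop33ii` — at the JUNK operations on the walking parallel pair `0 ⇉ 1` with base the
  walking arrow `0 → 1` (both arrows over the same non-invertible base arrow; `Φ = 0`, `deg_Fr = 1`): only
  identities are isometric pre-steps, so every object is isotropic and every unit is trivial; the two
  parallel arrows have the same `(deg_Fr, Div, Base)` but are not unit-equivalent.
Reading: the row is admissible AT NAMED INSTANCES ONLY (R5: Frobenioids, `remark311_holds`); the
counterexample isolates total epimorphicity of the base as the hypothesis that cannot be dropped (as for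
F-0862, `ArchFrd.not_prop35ii_C_retract`).  Refuted-closure ≠ refuted-paper; a FACT row is an assumption
label, not an endorsement; nothing here bears on [IUTchIII] Cor. 3.12.
-/

noncomputable section

namespace Literature.AlgebraicGeometry.Frobenioids

open CategoryTheory

/-- **Remark 3.1.1 fails for a pre-Frobenioid over a non-totally-epimorphic base**: for the honest
operations of the archimedean category `C₀ ×_{D₀} RB` over the retract base ([FrdII] Ex. 3.3 (i) with the
standing hypothesis "totally epimorphic" dropped), the object `U pt` is an isotropic iso-subanchor.
[cite: MochizukiFrdI2008, Rem. 3.1.1 p.57] -/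
theorem not_remark311_archRetract :
    ¬ Remark311 (PreFrobenioidData.ofFunctor _ (ArchFrd.C.toElem ArchFrd.πR)) := fun h =>
  h (ArchFrd.U ArchFrd.RB.pt) ArchFrd.isIsoSubanchor_unit
    ((PreFrobenioidData.ofFunctor_isIsotropic (ArchFrd.C.toElem ArchFrd.πR) (ArchFrd.U ArchFrd.RB.pt)).mpr
      ArchFrd.isIsotropic_unit)

/-- **FACT-LIST F-0920, universal closure REFUTED** (universe `0`; witness: the operations `ofFunctor` of
the [FrdII] Prop. 3.5 (ii) counterexample pre-Frobenioid, `not_remark311_archRetract`).  Instance form of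
record: `remark311_holds (hF : IsFrobenioid F)` — Remark 3.1.1 for the operations of EVERY Frobenioid.
[cite: MochizukiFrdI2008, Rem. 3.1.1 p.57] -/
theorem not_forall_remark311 :
    ¬ ∀ (C : Type) [Category.{0} C] (D : Type) [Category.{0} D] (S : PreFrobenioidData.{0} C D),
        Literature.AlgebraicGeometry.Frobenioids.Remark311 S := fun h =>
  not_remark311_archRetract (h _ _ _)


/-! ### Prop. 3.3 (ii) as typed over the bare interface (F-0916): junk operations on the parallel pair -/

open Limits in
/-- **FACT-LIST F-0916, universal closure REFUTED** (universe `0`).  Operations on the walking parallel pair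
`zero ⇉ one`: base `parallelPair f f` into the walking arrow `Fin 2` (`f : 0 → 1` not invertible), `Φ = 0`,
`deg_Fr = 1`.  An isometric pre-step has invertible base, so only identities qualify: both objects are
isotropic and `O^×(−) = {1}`, whence `≈^{O^×}` is equality; but `left ≠ right` share `(deg_Fr, Div, Base)`.
Instance form of record: `FrdI.Prop33ii_holds` (closed twin F-0706, every Frobenioid).
[cite: MochizukiFrdI2008, Prop. 3.3 (ii) p.59] -/
theorem not_forall_prop33ii :
    ¬ ∀ (C : Type) [Category.{0} C] (D : Type) [Category.{0} D] (S : PreFrobenioidData.{0} C D),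
        Literature.AlgebraicGeometry.Frobenioids.Prop33ii S := by
  intro h
  have h01 : (0 : Fin 2) ≤ 1 := Fin.zero_le _
  have hni : ¬ IsIso (homOfLE h01) := fun hiso =>
    absurd (leOfHom (inv (homOfLE h01)) : (1 : Fin 2) ≤ 0) (by decide)
  let S : PreFrobenioidData.{0} WalkingParallelPair (Fin 2) :=
    { base := parallelPair (homOfLE h01) (homOfLE h01)
      Mon := fun _ => PUnit
      pull := fun _ => MonoidHom.id _
      pull_id := fun _ _ => rfl
      pull_comp := fun _ _ _ => rfl
      div := fun _ => 1
      degFr := fun _ => 1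
      div_id := fun _ => rfl
      div_comp := fun _ _ => rfl
      degFr_id := fun _ => rfl
      degFr_comp := fun _ _ => (mul_one _).symm }
  -- endomorphisms of the parallel pair are identities
  have hend : ∀ {X : WalkingParallelPair} (f : X ⟶ X), f = 𝟙 X := by
    rintro X ⟨⟩
    rfl
  -- isometric pre-steps are identities (their base is invertible), so every object is isotropic
  have hiso : ∀ X : WalkingParallelPair, S.IsIsotropic X := by
    rintro X Y φ ⟨⟨-, hb⟩, -⟩
    change IsIso ((parallelPair (homOfLE h01) (homOfLE h01)).map φ) at hb
    cases φ with
    | id _ => exact IsIso.id _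
    | left => exact absurd (by simpa using hb) hni
    | right => exact absurd (by simpa using hb) hni
  let A : S.Istr := ⟨WalkingParallelPair.zero, hiso _⟩
  let B : S.Istr := ⟨WalkingParallelPair.one, hiso _⟩
  let α₁ : A ⟶ B := ObjectProperty.homMk WalkingParallelPairHom.left
  let α₂ : A ⟶ B := ObjectProperty.homMk WalkingParallelPairHom.right
  -- the three invariants of `left`, `right` agree …
  have hinv : S.degFr α₁.hom = S.degFr α₂.hom ∧ S.div α₁.hom = S.div α₂.hom ∧
      S.base.map α₁.hom = S.base.map α₂.hom := ⟨rfl, rfl, Subsingleton.elim _ _⟩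
  -- … so the schema would make them unit-equivalent; but units are trivial, so they would be equal
  obtain ⟨X, γ, β, δ, -, h1, h2⟩ := (h _ _ S α₁ α₂).mpr hinv
  have hδ : ObjectProperty.homMk δ.hom = 𝟙 X := by
    apply ObjectProperty.hom_ext
    exact hend δ.hom
  rw [hδ, Category.id_comp, ← h1] at h2
  have h3 : (WalkingParallelPairHom.right : WalkingParallelPair.zero ⟶ WalkingParallelPair.one) =
      WalkingParallelPairHom.left := congrArg InducedCategory.Hom.hom h2
  cases h3

/-- The instance form of record, restated as an `example` (nothing new): Remark 3.1.1 HOLDS for the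
operations of every Frobenioid. [cite: MochizukiFrdI2008, Rem. 3.1.1 p.57] -/
example {D : Type} [Category.{0} D] (Φ : Dᵒᵖ ⥤ CommMonCat.{0}) {C : Type} [Category.{0} C]
    (F : C ⥤ ElemFrobenioid Φ) (hF : PreFrobenioid.IsFrobenioid F) :
    Remark311 (PreFrobenioidData.ofFunctor Φ F) :=
  remark311_holds Φ F hF

/-! ### Prop. 3.3 (iv), (v) as typed over the bare interface (F-0918, F-0919): the same junk operations

APPENDED (abc-iut-f-045, same session; declarations above byte-identical).  FACT-LIST rows **F-0918**
`Prop33iv S` (Prop. 3.3 (iv) p. 60: `C^istr → F_Φ` factors through `C^un-tr` and `C^un-tr → F_Φ` is faithful)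
and **F-0919** `Prop33v S` (Prop. 3.3 (v) p. 60: `C → F_Φ` is an equivalence iff `C` is of `Aut`-ample,
unit-trivial and base-trivial type); closed twins PROVED for every Frobenioid (`PreFrobenioid.prop33iv_holds`,
F-0707 `FrdI.Prop33v_holds`).  Over the bare interface both closures are FALSE at the junk operations of
`not_forall_prop33ii` (packaged once as `exists_parallelPair_ops`): the parallel arrows `left ≠ right` share
`(deg_Fr, Div, Base)`, every object is isotropic / `Aut`-ample / unit-trivial / base-trivial, and unit-
equivalence is equality — so (iv) would identify `left`, `right` in `C^un-tr = C^istr/≈` (they are not: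
the composite closure of `≈^{O^×} = (=)` is `=`), and (v) would make them equal outright. -/

open Limits in
/-- **The junk operations on the walking parallel pair, packaged** (witness of `not_forall_prop33ii`,
re-built): base `parallelPair f f : (zero ⇉ one) → (0 → 1)`, `Φ = 0`, `deg_Fr = 1`; recorded properties:
every object isotropic; any two parallel arrows have the same `(deg_Fr, Div, Base)`; unit-equivalent
arrows of `C^istr` are EQUAL; `Aut`-ample, unit-trivial and base-trivial type.
[cite: MochizukiFrdI2008, Prop. 3.3 p.59] -/
theorem exists_parallelPair_ops :
    ∃ S : PreFrobenioidData.{0} WalkingParallelPair (Fin 2),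
      (∀ X, S.IsIsotropic X) ∧
      (∀ {X Y : WalkingParallelPair} (φ ψ : X ⟶ Y),
        S.degFr φ = S.degFr ψ ∧ S.div φ = S.div ψ ∧ S.base.map φ = S.base.map ψ) ∧
      (∀ {A B : S.Istr} (f g : A ⟶ B), S.UnitEquiv f g → f = g) ∧
      S.IsOfAutAmpleType ∧ S.IsOfUnitTrivialType ∧ S.IsOfBaseTrivialType := by
  have h01 : (0 : Fin 2) ≤ 1 := Fin.zero_le _
  have hni : ¬ IsIso (homOfLE h01) := fun hiso =>
    absurd (leOfHom (inv (homOfLE h01)) : (1 : Fin 2) ≤ 0) (by decide)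
  have hn01 : ¬ Nonempty ((0 : Fin 2) ≅ 1) := fun ⟨e⟩ => absurd (leOfHom e.inv : (1 : Fin 2) ≤ 0) (by decide)
  let S : PreFrobenioidData.{0} WalkingParallelPair (Fin 2) :=
    { base := parallelPair (homOfLE h01) (homOfLE h01)
      Mon := fun _ => PUnit
      pull := fun _ => MonoidHom.id _
      pull_id := fun _ _ => rfl
      pull_comp := fun _ _ _ => rfl
      div := fun _ => 1
      degFr := fun _ => 1
      div_id := fun _ => rfl
      div_comp := fun _ _ => rfl
      degFr_id := fun _ => rfl
      degFr_comp := fun _ _ => (mul_one _).symm }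
  -- endomorphisms and automorphisms of the parallel pair are trivial
  have hend : ∀ {X : WalkingParallelPair} (f : X ⟶ X), f = 𝟙 X := by
    rintro X ⟨⟩
    rfl
  have haut : ∀ {X : WalkingParallelPair} (δ : Aut X), δ = 1 := fun δ => Iso.ext (hend δ.hom)
  have hiso : ∀ X : WalkingParallelPair, S.IsIsotropic X := by
    rintro X Y φ ⟨⟨-, hb⟩, -⟩
    change IsIso ((parallelPair (homOfLE h01) (homOfLE h01)).map φ) at hb
    cases φ with
    | id _ => exact IsIso.id _
    | left => exact absurd (by simpa using hb) hni
    | right => exact absurd (by simpa using hb) hni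
  refine ⟨S, hiso, fun φ ψ => ⟨rfl, rfl, Subsingleton.elim _ _⟩, ?_, ⟨fun A β => ?_⟩, ⟨fun A => ?_⟩,
    ⟨fun A B hAB => ?_⟩⟩
  · -- unit-equivalence is equality
    rintro A B f g ⟨X, γ, β, δ, -, h1, h2⟩
    have hδ : ObjectProperty.homMk δ.hom = 𝟙 X := by
      apply ObjectProperty.hom_ext
      exact hend δ.hom
    rw [hδ, Category.id_comp, ← h1] at h2
    exact h2.symm
  · -- `Aut`-ample: the base is thin, so `β = mapIso (refl)`
    exact ⟨Iso.refl A, Iso.ext (Subsingleton.elim _ _)⟩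
  · -- unit-trivial: `Aut A = {1}`
    exact (Subgroup.eq_bot_iff_forall _).mpr fun δ _ => haut δ
  · -- base-trivial: distinct objects lie over the non-isomorphic `0`, `1`
    cases A <;> cases B
    · exact ⟨Iso.refl _⟩
    · exact absurd hAB hn01
    · exact absurd (hAB.map Iso.symm) hn01
    · exact ⟨Iso.refl _⟩

open Limits in
/-- **FACT-LIST F-0918, universal closure REFUTED** (universe `0`; witness `exists_parallelPair_ops`): the
second clause of `Prop33iv` would identify `left` and `right` in `C^un-tr = C^istr/≈^{O^×}`; but `≈^{O^×}`
is equality here, so is its composite/equivalence closure, and `left ≠ right`.  Instance form of record: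
`PreFrobenioid.prop33iv_holds (hF : IsFrobenioid F)`. [cite: MochizukiFrdI2008, Prop. 3.3 (iv) p.60] -/
theorem not_forall_prop33iv :
    ¬ ∀ (C : Type) [Category.{0} C] (D : Type) [Category.{0} D] (S : PreFrobenioidData.{0} C D),
        Literature.AlgebraicGeometry.Frobenioids.Prop33iv S := by
  intro h
  obtain ⟨S, hiso, hinv, hue, -, -, -⟩ := exists_parallelPair_ops
  let A : S.Istr := ⟨WalkingParallelPair.zero, hiso _⟩
  let B : S.Istr := ⟨WalkingParallelPair.one, hiso _⟩
  let α₁ : A ⟶ B := ObjectProperty.homMk WalkingParallelPairHom.left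
  let α₂ : A ⟶ B := ObjectProperty.homMk WalkingParallelPairHom.right
  obtain ⟨h1, h2, h3⟩ := hinv α₁.hom α₂.hom
  have hq : S.toUntr.map α₁ = S.toUntr.map α₂ := (h _ _ S).2 α₁ α₂ h1 h2 h3
  -- in the quotient, equality of classes is the equivalence closure of the composite closure of `≈`
  have hgen : Relation.EqvGen (@HomRel.CompClosure _ _ S.UnitEquiv A B) α₁ α₂ :=
    (CategoryTheory.Quotient.functor_homRel_eq_compClosure_eqvGen S.UnitEquiv α₁ α₂).mp hq
  have key : ∀ {f g : A ⟶ B}, Relation.EqvGen (@HomRel.CompClosure _ _ S.UnitEquiv A B) f g → f = g := by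
    intro f g hfg
    induction hfg with
    | rel _ _ hr =>
      obtain ⟨a, b, f, m₁, m₂, g, hm⟩ := hr
      rw [hue m₁ m₂ hm]
    | refl => rfl
    | symm _ _ _ ih => exact ih.symm
    | trans _ _ _ _ _ ih₁ ih₂ => exact ih₁.trans ih₂
  have h4 : (WalkingParallelPairHom.left : WalkingParallelPair.zero ⟶ WalkingParallelPair.one) =
      WalkingParallelPairHom.right := congrArg InducedCategory.Hom.hom (key hgen)
  cases h4

open Limits in
/-- **FACT-LIST F-0919, universal closure REFUTED** (universe `0`; witness `exists_parallelPair_ops`): the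
junk operations are of `Aut`-ample, unit-trivial and base-trivial type, so `Prop33v` would make `C → F_Φ`
"faithful on invariants" — but `left ≠ right` have the same `(Base, Div, deg_Fr)`.  Instance form of
record: `FrdI.Prop33v_holds` (closed twin F-0707, every Frobenioid). [cite: MochizukiFrdI2008, Prop. 3.3 (v) p.60] -/
theorem not_forall_prop33v :
    ¬ ∀ (C : Type) [Category.{0} C] (D : Type) [Category.{0} D] (S : PreFrobenioidData.{0} C D),
        Literature.AlgebraicGeometry.Frobenioids.Prop33v S := by
  intro h
  obtain ⟨S, -, hinv, -, haut, hunit, hbase⟩ := exists_parallelPair_ops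
  obtain ⟨h1, h2, h3⟩ := hinv WalkingParallelPairHom.left WalkingParallelPairHom.right
  have h4 := ((h _ _ S).mpr ⟨haut, hunit, hbase⟩).1 _ _ h3 h2 h1
  cases h4

end Literature.AlgebraicGeometry.Frobenioids

end
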